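import Literature.Analysis.FluidPDE.SawtoothCascadeDriftFree
import Literature.Analysis.FluidPDE.SawtoothCascadeSmooth
import Literature.Analysis.FluidPDE.PassiveScalarWellPosednessProofs
import Literature.Analysis.FluidPDE.PassiveScalarClassicalEnergy
import Literature.Analysis.FluidPDE.TorusClassicalNSMaximalSolution
import Literature.Analysis.FluidPDE.WeakSolutionProofs
import Literature.Analysis.FluidPDE.EulerReynolds
import Literature.Analysis.FluidPDE.TorusForceBookkeeping
import Summits.AnomalousDissipation.AnomalousDissipation.Theorems.SawtoothPulseCascadeK3LocalisedClosureForceBound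
import Summits.AnomalousDissipation.AnomalousDissipation.Theorems.SawtoothPulseCascadeK3LocalisedClosureEnergyFloor
import HarnessLib

/-!
# K3loc, line `DriftFree` — helper: `Existence P` from closed-window classical planar Navier–Stokes existence

Helper file of the lead prover for the crux `K3LocalisedClosure` (stmt-AnomalousDissipation-19492), route
`SawtoothPulseCascade`, line `DriftFree` (skeleton v3), stub `stub_existence`
(`∀ box, DriftFree.Existence ⟨γ, 1/4, 2, 1, ρN⟩`).  It reduces `Existence P` — for every `ν > 0`: a classical planar
Navier–Stokes solution on `[0,1) × 𝕋²` forced by `∂ₜū` from rest, the scalar it transports from `sin 2πx₁`, the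
forced weak formulation of the lift `(V, R)∘π` on `[0,1]`, and the cascade scalar itself — to the ONE input the tree
does not yet hold for `𝕋²`: classical solvability of the forced planar Navier–Stokes system on CLOSED windows
`[0, τ]`, `τ < 1` (2D global regularity; Ladyzhenskaya 1959, Foias–Manley–Rosa–Temam Thm. 7.4 / Kuksin–Shirikyan
Thm. 2.1.13 & 2.1.18–19 in the classical smooth-data form), `existence_of_windows`.  Everything else is assembled
here from the tree:

* §X1 classical scalar solutions are local in time (`IsClassicalScalarTransportOn.of_local_inter`, scalar twin of
  `Torus.IsClassicalNSSolutionOn.of_local_inter`) and exist on half-open windows `[0, T)` for `κ > 0`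
  (`exists_classicalScalar_Ico`: the tree's well-posedness `Torus.exists_unique_isClassicalScalarTransportForcedOn_holds`
  on the closed windows `[0, τ]`, glued by uniqueness);
* §X2 the lift `(V, R)∘π` of a classical planar solution on `[0,1)` with bounded force is a forced weak solution on
  `[0, 1]` (`isWeakNSSolutionForcedOn_lift`: classical ⇒ forced-weak on every `[0, T]`, `T < 1`,
  `Torus.IsClassicalNSSolutionOn.isWeakNSSolutionForcedOn_holds`; a test field for `T = 1` vanishes from some `T' < 1`
  on; `u ∈ L²((0,1) × T³)` by the energy bound of the helper `EnergyFloor` and `‖R(t)‖ ≤ ‖θ₀‖`);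
* §X3 the windows `[0, τ]` are glued along `[0,1)` by `Torus.classicalNS_exhaust_Ico`; the cascade field is
  divergence free on `[0,1)` (`isDivFree_field`, every time lies in a closed half-slot, `exists_mem_slot`).
-/

-- `Summit.<Summit>.<Problem>`: single-conjunct summit, the duplicate namespace segment is deliberate.
set_option linter.dupNamespace false

noncomputable section

namespace Summit.AnomalousDissipation.AnomalousDissipation.Theorems.SawtoothPulseCascade.DriftFreeExistence

open scoped InnerProductSpace ENNReal NNReal
open MeasureTheory Set Filter Topology
open Literature.Analysis Literature.Analysis.FunctionSpaces Literature.Analysis.FluidPDE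
open Literature.Analysis.FluidPDE.SawtoothCascade
open Literature.Analysis.FluidPDE.SawtoothCascade.DriftFree
open Literature.Analysis.FunctionSpaces.Torus (twoHalf planarProj)

/-! ## §X1 Classical scalars are local in time; exhaustion of a half-open window -/

section Scalar

variable {d : Type*} [Fintype d] [DecidableEq d] {κ : ℝ}
  {u : ℝ → UnitAddTorus d → EuclideanSpace ℝ d}

/-- **Classical scalar solutions are local in time.** If every `t ∈ S` has an open neighbourhood `O` carrying a
classical solution `θ'` of `∂ₜθ + u·∇θ = κΔθ` on `S ∩ O` with `θ' = θ` on `S ∩ O`, then `θ` is a classical solution on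
`S` (joint smoothness is local; the time derivative within `S` at `t ∈ S ∩ O` is the one within `S ∩ O`). Scalar twin
of `Torus.IsClassicalNSSolutionOn.of_local_inter`. [folklore] -/
theorem IsClassicalScalarTransportOn.of_local_inter {S : Set ℝ} {θ : ℝ → UnitAddTorus d → ℝ}
    (h : ∀ t ∈ S, ∃ O : Set ℝ, IsOpen O ∧ t ∈ O ∧ ∃ θ' : ℝ → UnitAddTorus d → ℝ,
      FluidPDE.Torus.IsClassicalScalarTransportOn (S ∩ O) κ u θ' ∧ ∀ s ∈ S ∩ O, θ' s = θ s) :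
    FluidPDE.Torus.IsClassicalScalarTransportOn S κ u θ := by
  have hset : ∀ O : Set ℝ,
      (S ×ˢ (univ : Set (EuclideanSpace ℝ d))) ∩ O ×ˢ univ = (S ∩ O) ×ˢ univ := fun O => by
    rw [prod_inter_prod, inter_self]
  refine ⟨?_, ?_, fun t ht x => ?_, fun t ht => ?_⟩
  · refine contDiffOn_of_locally_contDiffOn fun z hz => ?_
    obtain ⟨t, y⟩ := z
    obtain ⟨O, hO, htO, θ', h', -⟩ := h t (mem_prod.1 hz).1
    refine ⟨O ×ˢ univ, hO.prod isOpen_univ, ⟨htO, mem_univ _⟩, ?_⟩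
    rw [hset O]
    exact h'.smooth_velocity
  · refine contDiffOn_of_locally_contDiffOn fun z hz => ?_
    obtain ⟨t, y⟩ := z
    obtain ⟨O, hO, htO, θ', h', hθ'⟩ := h t (mem_prod.1 hz).1
    refine ⟨O ×ˢ univ, hO.prod isOpen_univ, ⟨htO, mem_univ _⟩, ?_⟩
    rw [hset O]
    exact h'.smooth_scalar.congr fun z hz => by
      obtain ⟨τ, y'⟩ := z
      simp only [FunctionSpaces.Torus.stLift_apply, hθ' τ (mem_prod.1 hz).1]
  · obtain ⟨O, hO, htO, θ', h', hθ'⟩ := h t ht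
    have htO' : t ∈ S ∩ O := ⟨ht, htO⟩
    have hD : FunctionSpaces.Torus.timeDerivWithin S θ t x =
        FunctionSpaces.Torus.timeDerivWithin (S ∩ O) θ' t x := by
      simp only [FunctionSpaces.Torus.timeDerivWithin]
      rw [derivWithin_inter (hO.mem_nhds htO)]
      refine (Filter.EventuallyEq.derivWithin_eq ?_ ?_).symm
      · filter_upwards [inter_mem_nhdsWithin S (hO.mem_nhds htO)] with τ hτ
        rw [hθ' τ hτ]
      · rw [hθ' t htO']
    rw [hD, ← hθ' t htO']
    exact h'.transport t htO' x
  · obtain ⟨O, -, htO, θ', h', -⟩ := h t ht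
    exact h'.divFree t ⟨ht, htO⟩

/-- **Classical scalar transport on a half-open window `[0, T)`** (`κ > 0`): for a drift `u` jointly smooth and
divergence free on `[0, T) × T^d` and a smooth datum `θ₀` there is a classical solution of `∂ₜθ + u·∇θ = κΔθ` on
`[0, T)` with `θ(0) = θ₀` — the tree's well-posedness on the closed windows `[0, τ]`, `τ < T`
(`Torus.exists_unique_isClassicalScalarTransportForcedOn_holds`), glued along `[0, T)` by uniqueness
(`θ(t) := θ_{(t+T)/2}(t)`). [folklore] -/
theorem exists_classicalScalar_Ico (hκ : 0 < κ) {T : ℝ} (hT : 0 < T)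
    (hu : FunctionSpaces.Torus.IsSmoothSpaceTimeOn (Ico 0 T) u)
    (hdiv : ∀ t ∈ Ico 0 T, FunctionSpaces.Torus.IsDivFree (u t))
    {θ₀ : UnitAddTorus d → ℝ} (hθ₀ : FunctionSpaces.Torus.IsSmooth θ₀) :
    ∃ θ : ℝ → UnitAddTorus d → ℝ, FluidPDE.Torus.IsClassicalScalarTransportOn (Ico 0 T) κ u θ ∧ θ 0 = θ₀ := by
  classical
  -- a solution package on every closed window `[0, τ]`, `τ ∈ (0, T)`
  have hwin : ∀ τ ∈ Ioo 0 T, ∃ θ : ℝ → UnitAddTorus d → ℝ,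
      FluidPDE.Torus.IsClassicalScalarTransportOn (Icc 0 τ) κ u θ ∧ θ 0 = θ₀ ∧
        ∀ θ' : ℝ → UnitAddTorus d → ℝ, FluidPDE.Torus.IsClassicalScalarTransportOn (Icc 0 τ) κ u θ' →
          θ' 0 = θ₀ → ∀ t ∈ Icc 0 τ, θ' t = θ t := by
    intro τ hτ
    have hI : Icc 0 τ ⊆ Ico 0 T := fun s hs => ⟨hs.1, hs.2.trans_lt hτ.2⟩
    exact FluidPDE.Torus.exists_unique_isClassicalScalarTransportOn_of_forced
      FluidPDE.Torus.exists_unique_isClassicalScalarTransportForcedOn_holds hκ hτ.1 (hu.mono hI)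
      (fun t ht => hdiv t (hI ht)) hθ₀
  choose! θ hθ hθ0 huniq using hwin
  -- consistency on the overlaps
  have hcons : ∀ {τ τ' : ℝ}, τ ∈ Ioo 0 T → τ' ∈ Ioo 0 T → ∀ s ∈ Icc 0 τ, s ≤ τ' → θ τ s = θ τ' s := by
    intro τ τ' hτ hτ' s hs hsτ'
    rcases eq_or_lt_of_le hs.1 with h0s | h0s
    · rw [← h0s, hθ0 τ hτ, hθ0 τ' hτ']
    · -- both restrict to classical solutions on `[0, s]`; uniqueness of the `s`-window package
      have hsT : s ∈ Ioo 0 T := ⟨h0s, hs.2.trans_lt hτ.2⟩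
      have h1 : FluidPDE.Torus.IsClassicalScalarTransportOn (Icc 0 s) κ u (θ τ) :=
        (hθ τ hτ).restrict_Icc h0s (Icc_subset_Icc le_rfl hs.2)
      have h2 : FluidPDE.Torus.IsClassicalScalarTransportOn (Icc 0 s) κ u (θ τ') :=
        (hθ τ' hτ').restrict_Icc h0s (Icc_subset_Icc le_rfl hsτ')
      rw [huniq s hsT (θ τ) h1 (hθ0 τ hτ) s ⟨hs.1, le_rfl⟩,
        huniq s hsT (θ τ') h2 (hθ0 τ' hτ') s ⟨hs.1, le_rfl⟩]
  -- the glued scalar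
  set σ : ℝ → ℝ := fun t => (t + T) / 2 with hσ
  have hσlt : ∀ t : ℝ, t < T → t < σ t := fun t ht => by simp only [hσ]; linarith
  have hσT : ∀ t : ℝ, t < T → σ t < T := fun t ht => by simp only [hσ]; linarith
  have hσmem : ∀ t ∈ Ico (0 : ℝ) T, σ t ∈ Ioo 0 T := fun t ht =>
    ⟨lt_of_le_of_lt ht.1 (hσlt t ht.2), hσT t ht.2⟩
  refine ⟨fun t => θ (σ t) t, ?_, ?_⟩
  · refine IsClassicalScalarTransportOn.of_local_inter fun t ht => ?_
    refine ⟨Iio (σ t), isOpen_Iio, hσlt t ht.2, θ (σ t), ?_, fun s hs => ?_⟩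
    · have hset : Ico 0 T ∩ Iio (σ t) = Ico 0 (σ t) := by
        ext τ
        simp only [mem_inter_iff, mem_Ico, mem_Iio]
        constructor
        · rintro ⟨⟨h1, -⟩, h3⟩; exact ⟨h1, h3⟩
        · rintro ⟨h1, h3⟩; exact ⟨⟨h1, h3.trans (hσT t ht.2)⟩, h3⟩
      rw [hset]
      exact (hθ (σ t) (hσmem t ht)).restrict Ico_subset_Icc_self (uniqueDiffOn_Ico 0 (σ t))
    · have hs' : s ∈ Ico (0 : ℝ) T := hs.1
      exact hcons (hσmem t ht) (hσmem s hs') s ⟨hs'.1, (mem_Iio.1 hs.2).le⟩ (hσlt s hs'.2).le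
  · show θ (σ 0) 0 = θ₀
    exact hθ0 (σ 0) (hσmem 0 ⟨le_rfl, hT⟩)

end Scalar


/-! ## §X2 The lift is a forced weak solution on the closed interval `[0, 1]` -/

section Lift

variable {P : CascadeParams} {ν : ℝ} {V : ℝ → UnitAddTorus (Fin 2) → EuclideanSpace ℝ (Fin 2)}
  {φ R : ℝ → UnitAddTorus (Fin 2) → ℝ}

/-- Slices of the lift have energy `∫‖(V,R)∘π‖² ≤ C² + ‖θ₀‖²` on `[0,1)` (energy bound of `V` from the force bound,
`‖R(t)‖² ≤ ‖R(0)‖²`). [folklore] -/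
theorem lintegral_lift_sq_le (hν : 0 < ν)
    (hV : FunctionSpaces.Torus.IsClassicalNSSolutionOn (Ico (0 : ℝ) 1) ν (planarForce P) V φ) (hV0 : V 0 = 0)
    (hR : FluidPDE.Torus.IsClassicalScalarTransportOn (Ico (0 : ℝ) 1) ν V R) {C : ℝ}
    (hC : ∀ t ∈ Ico (0 : ℝ) 1, ∀ y, ‖planarForce P t y‖ ≤ C) {t : ℝ} (ht : t ∈ Ico (0 : ℝ) 1) :
    ∫⁻ x, ‖twoHalf (V t) (R t) x‖ₑ ^ 2 ≤ ENNReal.ofReal (C ^ 2 + FluidPDE.Torus.scalarL2Sq (R 0)) := by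
  have hVs : FunctionSpaces.Torus.IsSmooth (V t) := hV.smooth_velocity.isSmooth_slice ht
  have hRs : FunctionSpaces.Torus.IsSmooth (R t) := hR.smooth_scalar.isSmooth_slice ht
  have hus : FunctionSpaces.Torus.IsSmooth (twoHalf (V t) (R t)) := hVs.twoHalf hRs
  have hint : Integrable (fun x => ‖twoHalf (V t) (R t) x‖ ^ 2) volume :=
    (hus.continuous.norm.pow 2).integrable_unitAddTorus
  have e1 : ∫⁻ x, ‖twoHalf (V t) (R t) x‖ₑ ^ 2 = ENNReal.ofReal (∫ x, ‖twoHalf (V t) (R t) x‖ ^ 2) := by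
    rw [ofReal_integral_eq_lintegral_ofReal hint (ae_of_all _ fun x => sq_nonneg _)]
    refine lintegral_congr fun x => ?_
    rw [← ofReal_norm, ENNReal.ofReal_pow (norm_nonneg _)]
  rw [e1, FluidPDE.Torus.integral_norm_sq_twoHalf hVs.continuous hRs.continuous]
  refine ENNReal.ofReal_le_ofReal (add_le_add ?_ ?_)
  · have hE := DriftFreeClosure.kineticEnergy_le_of_force_bound hν.le hV hV0 hC ht
    simp only [FunctionSpaces.Torus.kineticEnergy] at hE
    linarith
  · have hI : Icc 0 t ⊆ Ico (0 : ℝ) 1 := fun s hs => ⟨hs.1, hs.2.trans_lt ht.2⟩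
    have h := FluidPDE.Torus.IsClassicalScalarTransportOn.scalarL2Sq_add_scalarDissipation_holds hR ht.1 hI
    have hd : 0 ≤ FluidPDE.Torus.scalarDissipation ν R 0 t := FluidPDE.Torus.scalarDissipation_nonneg hν.le _ ht.1
    simp only [FluidPDE.Torus.scalarL2Sq] at h ⊢
    linarith

/-- **The lift `(V, R)∘π` is a forced weak Navier–Stokes solution on `[0, 1]`** from `liftedDatum` with force
`liftedForce P`: on every `[0, T]`, `T < 1`, it is classical (`DriftFree.liftClassical`), hence forced-weak
(`Torus.IsClassicalNSSolutionOn.isWeakNSSolutionForcedOn_holds`); a test field for `T = 1` vanishes from some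
`T' < 1` on, so its identity is the one on `[0, (max T' 0 + 1)/2]`; and `u ∈ L²((0,1) × T³)` by the energy bound up
to `t = 1`. [folklore] -/
theorem isWeakNSSolutionForcedOn_lift (hν : 0 < ν)
    (hV : FunctionSpaces.Torus.IsClassicalNSSolutionOn (Ico (0 : ℝ) 1) ν (planarForce P) V φ) (hV0 : V 0 = 0)
    (hR : FluidPDE.Torus.IsClassicalScalarTransportOn (Ico (0 : ℝ) 1) ν V R) (hR0 : R 0 = datum) {C : ℝ}
    (hC : ∀ t ∈ Ico (0 : ℝ) 1, ∀ y, ‖planarForce P t y‖ ≤ C) :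
    FluidPDE.Torus.IsWeakNSSolutionForcedOn 1 ν (liftedForce P) liftedDatum (fun t => twoHalf (V t) (R t)) := by
  set u : ℝ → UnitAddTorus (Fin 3) → EuclideanSpace ℝ (Fin 3) := fun t => twoHalf (V t) (R t) with hu_def
  have hu : FunctionSpaces.Torus.IsClassicalNSSolutionOn (Ico (0 : ℝ) 1) ν (liftedForce P) u
      (fun t => φ t ∘ planarProj) := liftClassical P ν V φ R hV hR
  have hu0 : u 0 = liftedDatum := by
    show twoHalf (V 0) (R 0) = liftedDatum
    rw [hV0, hR0]; rfl
  have hus := hu.smooth_velocity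
  refine ⟨?_, ?_, ?_, ?_⟩
  · exact hus.aestronglyMeasurable_stLift measurableSet_Ioo Ioo_subset_Ico_self
  · calc ∫⁻ t in Ioo (0 : ℝ) 1, ∫⁻ x, ‖u t x‖ₑ ^ 2
        ≤ ∫⁻ _ in Ioo (0 : ℝ) 1, ENNReal.ofReal (C ^ 2 + FluidPDE.Torus.scalarL2Sq (R 0)) :=
          setLIntegral_mono' measurableSet_Ioo fun t ht =>
            lintegral_lift_sq_le hν hV hV0 hR hC (Ioo_subset_Ico_self ht)
      _ = ENNReal.ofReal (C ^ 2 + FluidPDE.Torus.scalarL2Sq (R 0)) * volume (Ioo (0 : ℝ) 1) :=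
          setLIntegral_const _ _
      _ < ⊤ := ENNReal.mul_lt_top ENNReal.ofReal_lt_top (by rw [Real.volume_Ioo]; exact ENNReal.ofReal_lt_top)
  · refine (ae_restrict_iff' measurableSet_Ioo).2 (ae_of_all _ fun t ht => ?_)
    exact (hu.divFree t (Ioo_subset_Ico_self ht)).isWeaklyDivFree_holds (hus.isSmooth_slice (Ioo_subset_Ico_self ht))
  · intro ψ hψ hψdiv
    obtain ⟨hψs, T', hT'1, hT'⟩ := id hψ
    set T'' : ℝ := (max T' 0 + 1) / 2 with hT''
    have hT''pos : 0 < T'' := by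
      have := le_max_right T' 0; simp only [hT'']; linarith
    have hT''lt : T'' < 1 := by
      have : max T' 0 < 1 := max_lt hT'1 one_pos
      simp only [hT'']; linarith
    have hT'T'' : T' < T'' := by
      have := le_max_left T' 0
      have : max T' 0 < 1 := max_lt hT'1 one_pos
      simp only [hT'']; linarith
    have hψ'' : FunctionSpaces.Torus.IsSpaceTimeTest T'' ψ := ⟨hψs, T', hT'T'', hT'⟩
    have hI : Icc 0 T'' ⊆ Ico (0 : ℝ) 1 := fun s hs => ⟨hs.1, hs.2.trans_lt hT''lt⟩
    have hweak := FunctionSpaces.Torus.IsClassicalNSSolutionOn.isWeakNSSolutionForcedOn_holds hu hI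
    have hid := hweak.2.2.2 ψ hψ'' hψdiv
    rw [hu0] at hid
    -- the integrand vanishes on `[T'', 1)`
    have hzero : ∀ t ∈ Ioo (0 : ℝ) 1 \ Ioo 0 T'',
        (∫ x, (⟪u t x, FunctionSpaces.Torus.timeDeriv ψ t x⟫_ℝ +
          ⟪u t x, FunctionSpaces.Torus.convect (u t) (ψ t) x⟫_ℝ +
          ν * ⟪u t x, FunctionSpaces.Torus.laplacian (ψ t) x⟫_ℝ + ⟪liftedForce P t x, ψ t x⟫_ℝ)) = 0 := by
      intro t ht
      have htT'' : T'' ≤ t := by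
        by_contra h
        exact ht.2 ⟨ht.1.1, lt_of_not_ge h⟩
      have htT' : T' < t := hT'T''.trans_le htT''
      have hψt : ψ t = fun _ => 0 := by rw [hT' t htT'.le]; rfl
      have hdt : ∀ x, FunctionSpaces.Torus.timeDeriv ψ t x = 0 := by
        intro x
        simp only [FunctionSpaces.Torus.timeDeriv]
        have hev : (fun τ => ψ τ x) =ᶠ[𝓝 t] fun _ => (0 : EuclideanSpace ℝ (Fin 3)) := by
          filter_upwards [Ioi_mem_nhds htT'] with τ hτ
          rw [hT' τ (le_of_lt hτ)]; rfl
        rw [hev.deriv_eq, deriv_const]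
      refine integral_eq_zero_of_ae (ae_of_all _ fun x => ?_)
      simp only [hdt x, hψt, FluidPDE.Torus.convect_zero_right, FluidPDE.Torus.laplacian_zero, inner_zero_right,
        mul_zero, add_zero, Pi.zero_apply]
    rw [setIntegral_eq_of_subset_of_forall_sdiff_eq_zero measurableSet_Ioo (Ioo_subset_Ioo_right hT''lt.le) hzero]
    exact hid

end Lift

/-! ## §X3 Assembly of `Existence P` from closed-window planar Navier–Stokes existence -/

/-- Every `t ∈ [0,1)` lies in a closed half-slot of some phase. [folklore] -/
theorem exists_mem_slot {t : ℝ} (ht : t ∈ Ico (0 : ℝ) 1) :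
    ∃ j : ℕ, t ∈ Icc (CascadeParams.tStart j) (CascadeParams.tStart j + CascadeParams.tHalf j) ∨
      t ∈ Icc (CascadeParams.tStart j + CascadeParams.tHalf j) (CascadeParams.tStart (j + 1)) := by
  classical
  have hex : ∃ J, t < CascadeParams.tStart J :=
    ((tendsto_order.1 CascadeParams.tendsto_tStart).1 t ht.2).exists
  have hJt : t < CascadeParams.tStart (Nat.find hex) := Nat.find_spec hex
  have hJpos : Nat.find hex ≠ 0 := by
    intro h0
    rw [h0] at hJt
    exact absurd hJt (not_lt.2 (by simpa [CascadeParams.tStart] using ht.1))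
  obtain ⟨j, hj⟩ := Nat.exists_eq_succ_of_ne_zero hJpos
  rw [hj] at hJt
  have hjt : CascadeParams.tStart j ≤ t := by
    have := Nat.find_min hex (show j < Nat.find hex by rw [hj]; exact Nat.lt_succ_self j)
    exact not_lt.1 this
  refine ⟨j, ?_⟩
  by_cases h : t ≤ CascadeParams.tStart j + CascadeParams.tHalf j
  · exact Or.inl ⟨hjt, h⟩
  · exact Or.inr ⟨(lt_of_not_ge h).le, hJt.le⟩

/-- The cascade field is divergence free at every `t ∈ [0,1)` (it is a single shear on each half-slot). [folklore] -/
theorem isDivFree_field (P : CascadeParams) {t : ℝ} (ht : t ∈ Ico (0 : ℝ) 1) :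
    FunctionSpaces.Torus.IsDivFree (P.field t) := by
  obtain ⟨j, h | h⟩ := exists_mem_slot ht
  · exact P.isDivFree_field_of_mem_H h
  · exact P.isDivFree_field_of_mem_V h

/-- **`Existence P` from closed-window planar Navier–Stokes existence.**  If for every `ν > 0` and every `τ ∈ (0,1)`
the planar Navier–Stokes system forced by `planarForce P` has a classical solution from rest on `[0, τ] × 𝕋²`, and
the parameters satisfy `δ₀ > 0`, `d > 0`, `N₀ ≥ 1`, `ρN ≥ 2`, then `Existence P` holds: the windows are glued along
`[0,1)` (`Torus.classicalNS_exhaust_Ico`), the scalars exist on `[0,1)` (`exists_classicalScalar_Ico`, tree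
well-posedness on closed windows), and the lift is forced-weak on `[0,1]` (`isWeakNSSolutionForcedOn_lift`, energy
bound from `exists_norm_planarForce_le`). [folklore] -/
theorem existence_of_windows (P : CascadeParams) (hδ₀ : 0 < P.δ₀) (hd : 0 < P.d) (hN₀ : 1 ≤ P.N₀) (hρ : 2 ≤ P.ρN)
    (hNS : ∀ ν : ℝ, 0 < ν → ∀ τ ∈ Ioo (0 : ℝ) 1,
      ∃ (V : ℝ → UnitAddTorus (Fin 2) → EuclideanSpace ℝ (Fin 2)) (φ : ℝ → UnitAddTorus (Fin 2) → ℝ),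
        FunctionSpaces.Torus.IsClassicalNSSolutionOn (Icc 0 τ) ν (planarForce P) V φ ∧ V 0 = 0) :
    Existence P := by
  intro ν hν
  have hfs : CascadeFieldSmooth P := cascadeFieldSmooth P hδ₀ hd
  obtain ⟨C, hC⟩ := DriftFreeClosure.exists_norm_planarForce_le P hδ₀ hd hN₀ hρ
  obtain ⟨V, φ, hV, hV0, -⟩ := Torus.classicalNS_exhaust_Ico hν.le zero_lt_one (u₀ := 0) (hNS ν hν)
  obtain ⟨R, hR, hR0⟩ := exists_classicalScalar_Ico hν zero_lt_one hV.smooth_velocity hV.divFree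
    DriftFreeClosure.isSmooth_datum
  obtain ⟨w, hw, hw0⟩ := exists_classicalScalar_Ico hν zero_lt_one hfs (fun t ht => isDivFree_field P ht)
    DriftFreeClosure.isSmooth_datum
  exact ⟨⟨V, φ, R, hV, hV0, hR, hR0, isWeakNSSolutionForcedOn_lift hν hV hV0 hR hR0 hC⟩, w, hw, hw0⟩

end Summit.AnomalousDissipation.AnomalousDissipation.Theorems.SawtoothPulseCascade.DriftFreeExistence

end
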